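import Literature.MathematicalPhysics.QuantumFieldTheory.Balaban1983to89.B8ExpMeanLogCrossTermRec

/-!
# `Balaban1983to89.B8ExpMeanLogCrossTermPertRec` — [Balaban1985Averaging] (78)–(80): the one-step cross-term bound WITH PERTURBED INPUTS (the induction step of the tower form):
# if the base point and the site values are `e`-close to the products `a(y)u(y)`, `a(x)u(x)`, then `‖R̄₀(v)(y) − R̄₀(a)(y)·R̄₀(u)(y)‖ ≤ e + 128·(p + q + e)²` — Lipschitz constant ONE
# in the perturbation, so the defect accumulates ADDITIVELY down the tower; item (B′-5)′ of director-ym №312a's envelope, second piece (pen dag-n05-e g41)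

statement-level skeleton of published theorems with citation tags; proofs where landed; nothing here is a claim about the Yang–Mills mass gap

CITATION HEADER (lean-in-tree rule).  Cell `pub-ymgap` (HUMAN RULING D-0062), «N05-REC» road; director-ym №312a envelope item (B′-5)′ «cross-term bound» — one-step form ✓p745467
(`B8ExpMeanLogCrossTermRec.norm_avgStep_mul_sub_mul_le`); THIS FILE is the perturbed one-step form that drives the induction along `Rbar_succ`: at level `i + 1` the base point is
`R̄ⁱ(a·u)(L·y)` and the site values are `R̄ⁱ(a·u)(x)`, which by the induction hypothesis are `E_i`-close to the products `R̄ⁱa·R̄ⁱu`; the conclusion `E_{i+1} ≤ E_i + 128(p_i + q_i + E_i)²`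
has Lipschitz constant ONE in `E_i` (the base-point perturbation cancels to first order against the logarithms, exactly as in the covariance identities of `B8BlockConstantLiftDataRec`).
[3] = [Balaban1985Averaging] (78)–(80) p. 30, (21)–(25) p. 21; [15] = [Balaban1985Variational] (100) p. 47.  `--kind proof --supports stmt-QuantumFields-20541` (K0⁷; count-neutral;
no definition).  REUSED BY NAME: `B8ExpMeanLogCrossTermRec.{norm_wsum_le, norm_logOnePlus_sub_self_le, norm_exp_sub_one_le', norm_wsum_log_cross_le, norm_exp_sub_exp_mul_exp_le}`,
`OneLinkLaplace.norm_exp_sub_one_sub_le_sq`, `B7Prop6Flat.logOnePlus_conj`, `B7Eq78Linearization.{avgStep, avgStep_eq_mul_exp_sum, conjR_apply}`, Mathlib `NormedSpace.exp_units_conj'`.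

THE MATHEMATICS.  `w = a(y)u(y)(1 + η₀)`, `w⁻¹a(y)u(y) = 1 + ζ₀` (so `ζ₀ + η₀ = −ζ₀η₀`), `w⁻¹v(x) = (1 + ζ₀)(1 + γ_x) + δ_x` with `δ_x = w⁻¹(v(x) − a(x)u(x))`, `γ` as in the
unperturbed lemma; then `R̄₀(v)(y)∕(a(y)u(y)) − e^{A′}e^{B} = Σ w_xδ_x + [second order in (p+q+e)]`, every first-order occurrence of `ζ₀`, `η₀` cancelling.
WHAT IS PROVED (sorry-free).  ★★★ `norm_avgStep_sub_mul_le_of_near` — ‖avgStep t wt T w v − avgStep t wt T a(y) a · avgStep t wt T u(y) u‖ ≤ e + 128·(p+q+e)² under `U1` bounds,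
`‖a(y)⁻¹a(x) − 1‖ ≤ p`, `‖u(y)⁻¹u(x) − 1‖ ≤ q`, `‖(a(y)u(y))⁻¹w − 1‖ ≤ e`, `‖w⁻¹a(y)u(y) − 1‖ ≤ e`, `‖v(x) − a(x)u(x)‖ ≤ e`, `p + q + e ≤ 1∕16`.
HONEST SCOPE.  An elementary Banach-algebra estimate (ours, under №310's licence line — NOT a printed clause); the summation down the tower (`E_j ≤ Σ_{i<j} 128(p_i+q_i+E_i)² …`) and
the insertion into the crown's row 9′ are the junction's; `HThm4Rec*` CONDITIONAL; N05 DISCHARGED OF RECORD since R467 (count-neutral record-level work), N07 NOT discharged; counts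
unmoved (typed 28∕28 · discharged 8∕28); one finite 𝕋⁴ programme at fixed ε, `G = SU(2)` of record — nothing continuum ∕ ℝ⁴ ∕ OS ∕ mass gap ∕ Clay.  No `def`, no `instance`, no
`notation`, no `sorry`.
-/

set_option autoImplicit false

noncomputable section

open scoped BigOperators

namespace Literature.MathematicalPhysics.QuantumFieldTheory.Balaban1983to89.B8ExpMeanLogCrossTermPertRec

open NormedSpace
open Literature.Analysis.Complex (logOnePlus norm_logOnePlus_le_two_mul)
open MatrixLog (mlog mlog_def)
open B7Eq78Linearization (avgStep avgStep_eq_mul_exp_sum conjR conjR_apply)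
open B8ExpMeanLogCrossTermRec (norm_wsum_le norm_logOnePlus_sub_self_le norm_exp_sub_one_le' norm_wsum_log_cross_le norm_exp_sub_exp_mul_exp_le)

variable {𝔸 : Type*} [NormedRing 𝔸] [NormOneClass 𝔸] [NormedAlgebra ℂ 𝔸] [CompleteSpace 𝔸]

omit [NormOneClass 𝔸] [NormedAlgebra ℂ 𝔸] [CompleteSpace 𝔸] in
/-- `‖a + b + c + d‖ ≤ ‖a‖ + ‖b‖ + ‖c‖ + ‖d‖`. [folklore] -/
private theorem norm_add₄_le (a b c d : 𝔸) : ‖a + b + c + d‖ ≤ ‖a‖ + ‖b‖ + ‖c‖ + ‖d‖ :=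
  (norm_add_le _ _).trans (by linarith [norm_add₃_le (a := a) (b := b) (c := c)])

omit [NormOneClass 𝔸] [NormedAlgebra ℂ 𝔸] [CompleteSpace 𝔸] in
/-- The algebra behind `(a(y)u(y))⁻¹a(x)u(x) = (1 + α′)(1 + β)`: with `VW = 1`, `W(Pu) = 1 + (W(P−1)V + (Wu − 1) + W(P−1)V(Wu − 1))`. [folklore] -/
private theorem cross_alg (W V P u : 𝔸) (hVW : V * W = 1) :
    W * (P * u) = 1 + (W * (P - 1) * V + (W * u - 1) + W * (P - 1) * V * (W * u - 1)) := by
  have h : 1 + (W * (P - 1) * V + (W * u - 1) + W * (P - 1) * V * (W * u - 1)) = W * u + W * (P - 1) * (V * W) * u := by noncomm_ring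
  rw [h, hVW]; noncomm_ring

omit [NormOneClass 𝔸] [NormedAlgebra ℂ 𝔸] [CompleteSpace 𝔸] in
/-- `‖T₁T₂T₃‖`-type bound: `‖xyz‖ ≤ ‖x‖‖y‖‖z‖`. [folklore] -/
private theorem norm_mul₃_le (x y z : 𝔸) : ‖x * y * z‖ ≤ ‖x‖ * ‖y‖ * ‖z‖ :=
  (norm_mul_le _ _).trans (mul_le_mul_of_nonneg_right (norm_mul_le _ _) (norm_nonneg _))

/-- **Logarithmic side, perturbed**: with `μ = γ + ζ₀(1 + γ) + δ`, `‖γ‖ ≤ (17∕16)(p+q)`, `‖ζ₀‖, ‖δ‖ ≤ e`, `m = p + q + e ≤ 1∕16`: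
`‖Σ w log(1+μ) − Σ w log(1+γ) − (ζ₀ + Σ wδ)‖ ≤ 22m²` (the first-order part of the difference is exactly `ζ₀ + Σ wδ`). [cite: Balaban1985Averaging, (21)–(25) p.21, (78) p.30] -/
theorem norm_wsum_log_pert_le {ι : Type*} (t : Finset ι) {wt : ι → ℝ} (hw0 : ∀ x ∈ t, 0 ≤ wt x) (hw1 : ∑ x ∈ t, wt x = 1)
    (γ μ δ : ι → 𝔸) (ζ₀ : 𝔸) (hμ : ∀ x ∈ t, μ x = γ x + ζ₀ * (1 + γ x) + δ x) {p q e : ℝ} (hp0 : 0 ≤ p) (hq0 : 0 ≤ q) (he0 : 0 ≤ e)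
    (hsm : p + q + e ≤ 1 / 16) (hγn : ∀ x ∈ t, ‖γ x‖ ≤ 17 / 16 * (p + q)) (hζn : ‖ζ₀‖ ≤ e) (hδn : ∀ x ∈ t, ‖δ x‖ ≤ e) :
    ‖(∑ x ∈ t, wt x • logOnePlus (μ x)) - (∑ x ∈ t, wt x • logOnePlus (γ x)) - (ζ₀ + ∑ x ∈ t, wt x • δ x)‖ ≤ 22 * (p + q + e) ^ 2 := by
  have hμn : ∀ x ∈ t, ‖μ x‖ ≤ 3 * (p + q + e) := fun x hx => by
    rw [hμ x hx]
    calc ‖γ x + ζ₀ * (1 + γ x) + δ x‖ ≤ ‖γ x‖ + ‖ζ₀ * (1 + γ x)‖ + ‖δ x‖ := norm_add₃_le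
      _ ≤ ‖γ x‖ + ‖ζ₀‖ * (‖(1 : 𝔸)‖ + ‖γ x‖) + ‖δ x‖ := by
          gcongr; exact (norm_mul_le _ _).trans (mul_le_mul_of_nonneg_left (norm_add_le _ _) (norm_nonneg _))
      _ ≤ 17 / 16 * (p + q) + e * (1 + 17 / 16 * (p + q)) + e := by rw [norm_one]; gcongr <;> first | exact hγn x hx | exact hζn | exact hδn x hx
      _ ≤ 3 * (p + q + e) := by nlinarith
  have hμhalf : ∀ x ∈ t, ‖μ x‖ ≤ 1 / 2 := fun x hx => (hμn x hx).trans (by linarith)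
  have hγhalf : ∀ x ∈ t, ‖γ x‖ ≤ 1 / 2 := fun x hx => (hγn x hx).trans (by linarith)
  have hpt : ∀ x ∈ t, (logOnePlus (μ x) - μ x) - (logOnePlus (γ x) - γ x) + ζ₀ * γ x = logOnePlus (μ x) - logOnePlus (γ x) - (ζ₀ + δ x) := by
    intro x hx; rw [hμ x hx]; noncomm_ring
  have hrew : ∑ x ∈ t, wt x • ((logOnePlus (μ x) - μ x) - (logOnePlus (γ x) - γ x) + ζ₀ * γ x) =
      (∑ x ∈ t, wt x • logOnePlus (μ x)) - (∑ x ∈ t, wt x • logOnePlus (γ x)) - (ζ₀ + ∑ x ∈ t, wt x • δ x) := by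
    calc ∑ x ∈ t, wt x • ((logOnePlus (μ x) - μ x) - (logOnePlus (γ x) - γ x) + ζ₀ * γ x)
        = ∑ x ∈ t, (wt x • logOnePlus (μ x) - wt x • logOnePlus (γ x) - (wt x • ζ₀ + wt x • δ x)) :=
          Finset.sum_congr rfl fun x hx => by rw [hpt x hx, smul_sub, smul_sub, smul_add]
      _ = _ := by rw [Finset.sum_sub_distrib, Finset.sum_sub_distrib, Finset.sum_add_distrib, ← Finset.sum_smul, hw1, one_smul]
  rw [← hrew]
  refine norm_wsum_le t hw0 hw1 _ fun x hx => ?_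
  calc ‖(logOnePlus (μ x) - μ x) - (logOnePlus (γ x) - γ x) + ζ₀ * γ x‖
      ≤ ‖logOnePlus (μ x) - μ x‖ + ‖logOnePlus (γ x) - γ x‖ + ‖ζ₀ * γ x‖ := by
        linarith [norm_add_le ((logOnePlus (μ x) - μ x) - (logOnePlus (γ x) - γ x)) (ζ₀ * γ x),
          norm_sub_le (logOnePlus (μ x) - μ x) (logOnePlus (γ x) - γ x)]
    _ ≤ 2 * ‖μ x‖ ^ 2 + 2 * ‖γ x‖ ^ 2 + ‖ζ₀‖ * ‖γ x‖ := by
        gcongr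
        · exact norm_logOnePlus_sub_self_le (hμhalf x hx)
        · exact norm_logOnePlus_sub_self_le (hγhalf x hx)
        · exact norm_mul_le _ _
    _ ≤ 2 * (3 * (p + q + e)) ^ 2 + 2 * (17 / 16 * (p + q)) ^ 2 + e * (17 / 16 * (p + q)) := by
        gcongr
        · exact hμn x hx
        · exact hγn x hx
        · exact hγn x hx
    _ ≤ 22 * (p + q + e) ^ 2 := by nlinarith

omit [NormOneClass 𝔸] in
/-- **Assembly**: from the unperturbed cross term (`≤ 16(p+q)²`), the perturbed logarithmic side (`≤ 22m²`), the sizes of the exponents and `ζ₀ + η₀ = −ζ₀η₀`: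
`‖(1 + η₀)e^{Cμ} − e^{A′}e^{B}‖ ≤ e + 128m²`, the only first-order survivor being the mean perturbation `D = Σ wδ` (`‖D‖ ≤ e`). [cite: Balaban1985Averaging, (78) p.30, (21)–(25) p.21] -/
theorem norm_pert_exp_assembly_le (Cμ Cγ A' B ζ₀ η₀ D : 𝔸) {p q e : ℝ} (hp0 : 0 ≤ p) (hq0 : 0 ≤ q) (he0 : 0 ≤ e) (hsm : p + q + e ≤ 1 / 16)
    (hI : ‖exp Cγ - exp A' * exp B‖ ≤ 16 * (p + q) ^ 2) (hII : ‖Cμ - Cγ - (ζ₀ + D)‖ ≤ 22 * (p + q + e) ^ 2)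
    (hCμn : ‖Cμ‖ ≤ 6 * (p + q + e)) (hCγn : ‖Cγ‖ ≤ 17 / 8 * (p + q)) (hζn : ‖ζ₀‖ ≤ e) (hηn : ‖η₀‖ ≤ e) (hζη : ζ₀ + η₀ = -(ζ₀ * η₀))
    (hD : ‖D‖ ≤ e) :
    ‖(1 + η₀) * exp Cμ - exp A' * exp B‖ ≤ e + 128 * (p + q + e) ^ 2 := by
  letI : NormedAlgebra ℝ 𝔸 := NormedAlgebra.restrictScalars ℝ ℂ 𝔸
  set m : ℝ := p + q + e with hm
  have hm0 : 0 ≤ m := by positivity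
  have hem : e ≤ m := by rw [hm]; linarith
  have hC1 : ‖Cμ‖ ≤ 1 := hCμn.trans (by linarith)
  have hCγ1 : ‖Cγ‖ ≤ 1 := hCγn.trans (by linarith)
  have hR1 : ‖exp Cμ - 1 - Cμ‖ ≤ 36 * m ^ 2 := by
    calc ‖exp Cμ - 1 - Cμ‖ ≤ ‖Cμ‖ ^ 2 := OneLinkLaplace.norm_exp_sub_one_sub_le_sq hC1
      _ ≤ (6 * m) ^ 2 := by gcongr
      _ = 36 * m ^ 2 := by ring
  have hR2 : ‖exp Cγ - 1 - Cγ‖ ≤ 5 * m ^ 2 := by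
    calc ‖exp Cγ - 1 - Cγ‖ ≤ ‖Cγ‖ ^ 2 := OneLinkLaplace.norm_exp_sub_one_sub_le_sq hCγ1
      _ ≤ (17 / 8 * (p + q)) ^ 2 := by gcongr
      _ ≤ 5 * m ^ 2 := by rw [hm]; nlinarith
  have hR3 : ‖η₀ * (exp Cμ - 1)‖ ≤ 9 * m ^ 2 := by
    calc ‖η₀ * (exp Cμ - 1)‖ ≤ ‖η₀‖ * ‖exp Cμ - 1‖ := norm_mul_le _ _
      _ ≤ e * (‖Cμ‖ + ‖Cμ‖ ^ 2) := by gcongr; exact norm_exp_sub_one_le' hC1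
      _ ≤ m * (6 * m + (6 * m) ^ 2) := by gcongr
      _ ≤ 9 * m ^ 2 := by nlinarith [mul_nonneg (mul_nonneg hm0 hm0) (by linarith : (0:ℝ) ≤ 1 / 16 - m)]
  have hR4 : ‖ζ₀ * η₀‖ ≤ m ^ 2 := by
    calc ‖ζ₀ * η₀‖ ≤ ‖ζ₀‖ * ‖η₀‖ := norm_mul_le _ _
      _ ≤ m * m := by gcongr <;> linarith
      _ = m ^ 2 := by ring
  have hI' : ‖exp Cγ - exp A' * exp B‖ ≤ 16 * m ^ 2 := hI.trans (by rw [hm]; nlinarith)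
  have hrew : (1 + η₀) * exp Cμ - exp A' * exp B =
      ((exp Cμ - 1 - Cμ) + -(exp Cγ - 1 - Cγ) + (Cμ - Cγ - (ζ₀ + D)) + (ζ₀ + η₀)) + D + η₀ * (exp Cμ - 1) + (exp Cγ - exp A' * exp B) := by
    noncomm_ring
  rw [hrew, hζη]
  calc ‖((exp Cμ - 1 - Cμ) + -(exp Cγ - 1 - Cγ) + (Cμ - Cγ - (ζ₀ + D)) + -(ζ₀ * η₀)) + D + η₀ * (exp Cμ - 1) + (exp Cγ - exp A' * exp B)‖
      ≤ ‖(exp Cμ - 1 - Cμ) + -(exp Cγ - 1 - Cγ) + (Cμ - Cγ - (ζ₀ + D)) + -(ζ₀ * η₀)‖ + ‖D‖ + ‖η₀ * (exp Cμ - 1)‖ + ‖exp Cγ - exp A' * exp B‖ :=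
        norm_add₄_le _ _ _ _
    _ ≤ (36 * m ^ 2 + 5 * m ^ 2 + 22 * m ^ 2 + m ^ 2) + e + 9 * m ^ 2 + 16 * m ^ 2 := by
        gcongr
        calc ‖(exp Cμ - 1 - Cμ) + -(exp Cγ - 1 - Cγ) + (Cμ - Cγ - (ζ₀ + D)) + -(ζ₀ * η₀)‖
            ≤ ‖exp Cμ - 1 - Cμ‖ + ‖-(exp Cγ - 1 - Cγ)‖ + ‖Cμ - Cγ - (ζ₀ + D)‖ + ‖-(ζ₀ * η₀)‖ := norm_add₄_le _ _ _ _
          _ ≤ 36 * m ^ 2 + 5 * m ^ 2 + 22 * m ^ 2 + m ^ 2 := by rw [norm_neg, norm_neg]; gcongr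
    _ ≤ e + 128 * m ^ 2 := by nlinarith

/-- ★★★ **THE PERTURBED ONE-STEP CROSS-TERM BOUND** ((78), trivial transporters, nonnegative weights of mass one; `U1` values): if the base point `w` and the site values `v(x)` are
`e`-close (multiplicatively at the base, additively at the sites) to `a(y)u(y)`, `a(x)u(x)`, and `a`, `u` oscillate by `p`, `q` around their centre values, `p + q + e ≤ 1∕16`, then
`‖R̄₀(v)(y) − R̄₀(a)(y)·R̄₀(u)(y)‖ ≤ e + 128·(p + q + e)²` — Lipschitz constant ONE in `e`.  (Tower induction: `E_{i+1} ≤ E_i + 128(p_i + q_i + E_i)²`.)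
[cite: Balaban1985Averaging, (78)–(80) p.30, (21)–(25) p.21; Balaban1985Variational, (100) p.47] -/
theorem norm_avgStep_sub_mul_le_of_near {ι : Type*} (t : Finset ι) {wt : ι → ℝ} (hw0 : ∀ x ∈ t, 0 ≤ wt x) (hw1 : ∑ x ∈ t, wt x = 1)
    {T : ι → 𝔸ˣ} (hT : ∀ x ∈ t, T x = 1) (ay uy w : 𝔸ˣ)
    (hay : ‖(ay : 𝔸)‖ ≤ 1) (huy : ‖(uy : 𝔸)‖ ≤ 1) (huy' : ‖((uy⁻¹ : 𝔸ˣ) : 𝔸)‖ ≤ 1) (hw' : ‖((w⁻¹ : 𝔸ˣ) : 𝔸)‖ ≤ 1)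
    (a u v : ι → 𝔸) {p q e : ℝ} (hp0 : 0 ≤ p) (hq0 : 0 ≤ q) (he0 : 0 ≤ e) (hsm : p + q + e ≤ 1 / 16)
    (hpa : ∀ x ∈ t, ‖((ay⁻¹ : 𝔸ˣ) : 𝔸) * a x - 1‖ ≤ p) (hqu : ∀ x ∈ t, ‖((uy⁻¹ : 𝔸ˣ) : 𝔸) * u x - 1‖ ≤ q)
    (hη₀ : ‖(((ay * uy)⁻¹ : 𝔸ˣ) : 𝔸) * (w : 𝔸) - 1‖ ≤ e) (hζ₀ : ‖((w⁻¹ : 𝔸ˣ) : 𝔸) * ((ay * uy : 𝔸ˣ) : 𝔸) - 1‖ ≤ e)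
    (hδ : ∀ x ∈ t, ‖v x - a x * u x‖ ≤ e) :
    ‖avgStep t wt T (w : 𝔸) v - avgStep t wt T (ay : 𝔸) a * avgStep t wt T (uy : 𝔸) u‖ ≤ e + 128 * (p + q + e) ^ 2 := by
  letI : NormedAlgebra ℚ 𝔸 := NormedAlgebra.restrictScalars ℚ ℂ 𝔸
  letI : NormedAlgebra ℝ 𝔸 := NormedAlgebra.restrictScalars ℝ ℂ 𝔸
  have hp : p ≤ 1 / 8 := by linarith
  have hq : q ≤ 1 / 8 := by linarith
  have he : e ≤ 1 / 16 := by linarith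
  -- opaque names
  obtain ⟨α, hα⟩ : ∃ α : ι → 𝔸, ∀ x, α x = ((ay⁻¹ : 𝔸ˣ) : 𝔸) * a x - 1 := ⟨_, fun _ => rfl⟩
  obtain ⟨β, hβ⟩ : ∃ β : ι → 𝔸, ∀ x, β x = ((uy⁻¹ : 𝔸ˣ) : 𝔸) * u x - 1 := ⟨_, fun _ => rfl⟩
  obtain ⟨α', hα'⟩ : ∃ α' : ι → 𝔸, ∀ x, α' x = ((uy⁻¹ : 𝔸ˣ) : 𝔸) * α x * (uy : 𝔸) := ⟨_, fun _ => rfl⟩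
  obtain ⟨γ, hγ⟩ : ∃ γ : ι → 𝔸, ∀ x, γ x = α' x + β x + α' x * β x := ⟨_, fun _ => rfl⟩
  obtain ⟨ζ₀, hζ⟩ : ∃ ζ₀ : 𝔸, ζ₀ = ((w⁻¹ : 𝔸ˣ) : 𝔸) * ((ay * uy : 𝔸ˣ) : 𝔸) - 1 := ⟨_, rfl⟩
  obtain ⟨η₀, hη⟩ : ∃ η₀ : 𝔸, η₀ = (((ay * uy)⁻¹ : 𝔸ˣ) : 𝔸) * (w : 𝔸) - 1 := ⟨_, rfl⟩
  obtain ⟨δ, hδ'⟩ : ∃ δ : ι → 𝔸, ∀ x, δ x = ((w⁻¹ : 𝔸ˣ) : 𝔸) * (v x - a x * u x) := ⟨_, fun _ => rfl⟩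
  obtain ⟨μ, hμ⟩ : ∃ μ : ι → 𝔸, ∀ x, μ x = γ x + ζ₀ * (1 + γ x) + δ x := ⟨_, fun _ => rfl⟩
  -- sizes of the small quantities
  have hαn : ∀ x ∈ t, ‖α x‖ ≤ p := fun x hx => by rw [hα]; exact hpa x hx
  have hβn : ∀ x ∈ t, ‖β x‖ ≤ q := fun x hx => by rw [hβ]; exact hqu x hx
  have hα'n : ∀ x ∈ t, ‖α' x‖ ≤ p := fun x hx => by
    rw [hα']
    calc ‖((uy⁻¹ : 𝔸ˣ) : 𝔸) * α x * (uy : 𝔸)‖ ≤ ‖((uy⁻¹ : 𝔸ˣ) : 𝔸)‖ * ‖α x‖ * ‖(uy : 𝔸)‖ := norm_mul₃_le _ _ _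
      _ ≤ 1 * p * 1 := by
          gcongr
          exact hαn x hx
      _ = p := by ring
  have hγn : ∀ x ∈ t, ‖γ x‖ ≤ 17 / 16 * (p + q) := fun x hx => by
    rw [hγ]
    calc ‖α' x + β x + α' x * β x‖ ≤ ‖α' x‖ + ‖β x‖ + ‖α' x * β x‖ := norm_add₃_le
      _ ≤ p + q + p * q := by
        gcongr
        · exact hα'n x hx
        · exact hβn x hx
        · exact (norm_mul_le _ _).trans (mul_le_mul (hα'n x hx) (hβn x hx) (norm_nonneg _) hp0)
      _ ≤ 17 / 16 * (p + q) := by nlinarith [sq_nonneg (p - q)]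
  have hζn : ‖ζ₀‖ ≤ e := by rw [hζ]; exact hζ₀
  have hηn : ‖η₀‖ ≤ e := by rw [hη]; exact hη₀
  have hδn : ∀ x ∈ t, ‖δ x‖ ≤ e := fun x hx => by
    rw [hδ']
    calc ‖((w⁻¹ : 𝔸ˣ) : 𝔸) * (v x - a x * u x)‖ ≤ ‖((w⁻¹ : 𝔸ˣ) : 𝔸)‖ * ‖v x - a x * u x‖ := norm_mul_le _ _
      _ ≤ 1 * e := by gcongr; exact hδ x hx
      _ = e := one_mul e
  have hμn : ∀ x ∈ t, ‖μ x‖ ≤ 3 * (p + q + e) := fun x hx => by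
    rw [hμ]
    calc ‖γ x + ζ₀ * (1 + γ x) + δ x‖ ≤ ‖γ x‖ + ‖ζ₀ * (1 + γ x)‖ + ‖δ x‖ := norm_add₃_le
      _ ≤ ‖γ x‖ + ‖ζ₀‖ * (‖(1 : 𝔸)‖ + ‖γ x‖) + ‖δ x‖ := by
          gcongr; exact (norm_mul_le _ _).trans (mul_le_mul_of_nonneg_left (norm_add_le _ _) (norm_nonneg _))
      _ ≤ 17 / 16 * (p + q) + e * (1 + 17 / 16 * (p + q)) + e := by rw [norm_one]; gcongr <;> first | exact hγn x hx | exact hζn | exact hδn x hx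
      _ ≤ 3 * (p + q + e) := by nlinarith
  have hμhalf : ∀ x ∈ t, ‖μ x‖ ≤ 1 / 2 := fun x hx => (hμn x hx).trans (by linarith)
  have hγhalf : ∀ x ∈ t, ‖γ x‖ ≤ 1 / 2 := fun x hx => (hγn x hx).trans (by linarith)
  -- key algebra
  have huu : (uy : 𝔸) * ((uy⁻¹ : 𝔸ˣ) : 𝔸) = 1 := Units.mul_inv uy
  have hmlog : ∀ z : 𝔸, mlog (1 + z) = logOnePlus z := fun z => by rw [mlog_def, add_sub_cancel_left]
  have hprod : ∀ x ∈ t, (((ay * uy)⁻¹ : 𝔸ˣ) : 𝔸) * (a x * u x) = 1 + γ x := by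
    intro x hx
    rw [mul_inv_rev, Units.val_mul, hγ, hα', hβ, hα]
    rw [show ((uy⁻¹ : 𝔸ˣ) : 𝔸) * ((ay⁻¹ : 𝔸ˣ) : 𝔸) * (a x * u x) = ((uy⁻¹ : 𝔸ˣ) : 𝔸) * ((((ay⁻¹ : 𝔸ˣ) : 𝔸) * a x) * u x) by noncomm_ring]
    exact cross_alg _ _ _ _ huu
  have hkeyV : ∀ x ∈ t, Ring.inverse (w : 𝔸) * conjR (T x) (v x) = 1 + μ x := by
    intro x hx
    rw [Ring.inverse_unit, hT x hx, conjR_apply, Units.val_one, inv_one, Units.val_one, one_mul, mul_one, hμ, hδ', hζ]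
    -- `w⁻¹ v = w⁻¹(ay uy)·(ay uy)⁻¹(a u) + w⁻¹(v − a u)`
    have h1 : ((w⁻¹ : 𝔸ˣ) : 𝔸) * v x =
        ((w⁻¹ : 𝔸ˣ) : 𝔸) * ((ay * uy : 𝔸ˣ) : 𝔸) * ((((ay * uy)⁻¹ : 𝔸ˣ) : 𝔸) * (a x * u x)) + ((w⁻¹ : 𝔸ˣ) : 𝔸) * (v x - a x * u x) := by
      rw [mul_sub, ← mul_assoc, mul_assoc ((w⁻¹ : 𝔸ˣ) : 𝔸) ((ay * uy : 𝔸ˣ) : 𝔸), Units.mul_inv, mul_one]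
      abel
    rw [h1, hprod x hx]
    noncomm_ring
  have hkeyA : ∀ x ∈ t, Ring.inverse (ay : 𝔸) * conjR (T x) (a x) = 1 + α x := by
    intro x hx
    rw [Ring.inverse_unit, hT x hx, conjR_apply, Units.val_one, inv_one, Units.val_one, one_mul, mul_one, hα, add_sub_cancel]
  have hkeyB : ∀ x ∈ t, Ring.inverse (uy : 𝔸) * conjR (T x) (u x) = 1 + β x := by
    intro x hx
    rw [Ring.inverse_unit, hT x hx, conjR_apply, Units.val_one, inv_one, Units.val_one, one_mul, mul_one, hβ, add_sub_cancel]
  -- the exponents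
  obtain ⟨Cμ, hCμ⟩ : ∃ Cμ : 𝔸, Cμ = ∑ x ∈ t, wt x • logOnePlus (μ x) := ⟨_, rfl⟩
  obtain ⟨Cγ, hCγ⟩ : ∃ Cγ : 𝔸, Cγ = ∑ x ∈ t, wt x • logOnePlus (γ x) := ⟨_, rfl⟩
  obtain ⟨A', hA'⟩ : ∃ A' : 𝔸, A' = ∑ x ∈ t, wt x • logOnePlus (α' x) := ⟨_, rfl⟩
  obtain ⟨B, hB⟩ : ∃ B : 𝔸, B = ∑ x ∈ t, wt x • logOnePlus (β x) := ⟨_, rfl⟩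
  have hLHS : avgStep t wt T (w : 𝔸) v = (w : 𝔸) * exp Cμ := by
    rw [avgStep_eq_mul_exp_sum, hCμ]
    congr 2
    exact Finset.sum_congr rfl fun x hx => by rw [hkeyV x hx, hmlog]
  have hRa : avgStep t wt T (ay : 𝔸) a = (ay : 𝔸) * exp (∑ x ∈ t, wt x • logOnePlus (α x)) := by
    rw [avgStep_eq_mul_exp_sum]
    congr 2
    exact Finset.sum_congr rfl fun x hx => by rw [hkeyA x hx, hmlog]
  have hRu : avgStep t wt T (uy : 𝔸) u = (uy : 𝔸) * exp B := by
    rw [avgStep_eq_mul_exp_sum, hB]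
    congr 2
    exact Finset.sum_congr rfl fun x hx => by rw [hkeyB x hx, hmlog]
  have hA'eq : ((uy⁻¹ : 𝔸ˣ) : 𝔸) * (∑ x ∈ t, wt x • logOnePlus (α x)) * (uy : 𝔸) = A' := by
    rw [hA', Finset.mul_sum, Finset.sum_mul]
    refine Finset.sum_congr rfl fun x _ => ?_
    rw [mul_smul_comm, smul_mul_assoc, hα']
    congr 1
    have h := B7Prop6Flat.logOnePlus_conj uy⁻¹ (α x)
    rw [inv_inv] at h
    exact h.symm
  have hRHS : (ay : 𝔸) * exp (∑ x ∈ t, wt x • logOnePlus (α x)) * ((uy : 𝔸) * exp B) = (ay : 𝔸) * (uy : 𝔸) * (exp A' * exp B) := by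
    rw [← hA'eq, NormedSpace.exp_units_conj']
    calc (ay : 𝔸) * exp (∑ x ∈ t, wt x • logOnePlus (α x)) * ((uy : 𝔸) * exp B)
        = (ay : 𝔸) * ((uy : 𝔸) * ((uy⁻¹ : 𝔸ˣ) : 𝔸)) * exp (∑ x ∈ t, wt x • logOnePlus (α x)) * ((uy : 𝔸) * exp B) := by rw [huu, mul_one]
      _ = _ := by noncomm_ring
  -- `w = (ay uy)(1 + η₀)`
  have hw_eq : (w : 𝔸) = (ay : 𝔸) * (uy : 𝔸) * (1 + η₀) := by
    rw [hη, add_sub_cancel, ← Units.val_mul, Units.mul_inv_cancel_left]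
  -- `ζ₀ + η₀ = −ζ₀η₀`
  have hζη : ζ₀ + η₀ = -(ζ₀ * η₀) := by
    rw [hζ, hη]
    have h1 : ((w⁻¹ : 𝔸ˣ) : 𝔸) * ((ay * uy : 𝔸ˣ) : 𝔸) * ((((ay * uy)⁻¹ : 𝔸ˣ) : 𝔸) * (w : 𝔸)) = 1 := by
      rw [← mul_assoc, mul_assoc ((w⁻¹ : 𝔸ˣ) : 𝔸), Units.mul_inv, mul_one, Units.inv_mul]
    have h2 : (((w⁻¹ : 𝔸ˣ) : 𝔸) * ((ay * uy : 𝔸ˣ) : 𝔸) - 1) * ((((ay * uy)⁻¹ : 𝔸ˣ) : 𝔸) * (w : 𝔸) - 1) =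
        ((w⁻¹ : 𝔸ˣ) : 𝔸) * ((ay * uy : 𝔸ˣ) : 𝔸) * ((((ay * uy)⁻¹ : 𝔸ˣ) : 𝔸) * (w : 𝔸)) -
          ((w⁻¹ : 𝔸ˣ) : 𝔸) * ((ay * uy : 𝔸ˣ) : 𝔸) - (((ay * uy)⁻¹ : 𝔸ˣ) : 𝔸) * (w : 𝔸) + 1 := by noncomm_ring
    rw [h2, h1]
    abel
  -- norms of the exponents
  have hCμn : ‖Cμ‖ ≤ 6 * (p + q + e) := by
    rw [hCμ]
    refine norm_wsum_le t hw0 hw1 _ fun x hx => ?_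
    exact (norm_logOnePlus_le_two_mul (hμhalf x hx)).trans (by linarith [hμn x hx])
  have hCγn : ‖Cγ‖ ≤ 17 / 8 * (p + q) := by
    rw [hCγ]
    refine norm_wsum_le t hw0 hw1 _ fun x hx => ?_
    exact (norm_logOnePlus_le_two_mul (hγhalf x hx)).trans (by linarith [hγn x hx])
  have hAn : ‖A'‖ ≤ 2 * p := by
    rw [hA']
    exact norm_wsum_le t hw0 hw1 _ fun x hx => (norm_logOnePlus_le_two_mul ((hα'n x hx).trans (by linarith))).trans (by linarith [hα'n x hx])
  have hBn : ‖B‖ ≤ 2 * q := by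
    rw [hB]
    exact norm_wsum_le t hw0 hw1 _ fun x hx => (norm_logOnePlus_le_two_mul ((hβn x hx).trans (by linarith))).trans (by linarith [hβn x hx])
  -- (I) the unperturbed cross term: `‖e^{Cγ} − e^{A′}e^B‖ ≤ 16(p+q)²`
  have hI : ‖exp Cγ - exp A' * exp B‖ ≤ 16 * (p + q) ^ 2 := by
    have hlog := norm_wsum_log_cross_le t hw0 hw1 α' β γ (fun x _ => hγ x) hp0 hq0 hp hq hα'n hβn
    rw [← hCγ, ← hA', ← hB] at hlog
    exact norm_exp_sub_exp_mul_exp_le _ _ _ hp0 hq0 hp hq hlog hCγn hAn hBn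
  -- (II) the perturbed logarithmic side and (III) the assembly
  have hII : ‖Cμ - Cγ - (ζ₀ + ∑ x ∈ t, wt x • δ x)‖ ≤ 22 * (p + q + e) ^ 2 := by
    rw [hCμ, hCγ]
    exact norm_wsum_log_pert_le t hw0 hw1 γ μ δ ζ₀ (fun x _ => hμ x) hp0 hq0 he0 hsm hγn hζn hδn
  have hmean : ‖∑ x ∈ t, wt x • δ x‖ ≤ e := norm_wsum_le t hw0 hw1 _ hδn
  have hT : ‖(1 + η₀) * exp Cμ - exp A' * exp B‖ ≤ e + 128 * (p + q + e) ^ 2 :=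
    norm_pert_exp_assembly_le Cμ Cγ A' B ζ₀ η₀ _ hp0 hq0 he0 hsm hI hII hCμn hCγn hζn hηn hζη hmean
  -- finish
  rw [hLHS, hRa, hRu, hRHS, hw_eq, mul_assoc ((ay : 𝔸) * (uy : 𝔸)) (1 + η₀) (exp Cμ), ← mul_sub]
  calc ‖(ay : 𝔸) * (uy : 𝔸) * ((1 + η₀) * exp Cμ - exp A' * exp B)‖
      ≤ ‖(ay : 𝔸)‖ * ‖(uy : 𝔸)‖ * ‖(1 + η₀) * exp Cμ - exp A' * exp B‖ := norm_mul₃_le _ _ _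
    _ ≤ 1 * 1 * (e + 128 * (p + q + e) ^ 2) := by gcongr
    _ = e + 128 * (p + q + e) ^ 2 := by ring

end Literature.MathematicalPhysics.QuantumFieldTheory.Balaban1983to89.B8ExpMeanLogCrossTermPertRec
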